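import Literature.MathematicalPhysics.KineticTheory.LinearLorentzBoltzmannDuality
import Mathlib.Order.LiminfLimsup
import HarnessLib

/-!
# Preliminaries for the core of Gallavotti's theorem: mass one, superadditivity, reduction to a
# lower bound
(trunk T-KINETIC; topic MathematicalPhysics/KineticTheory; proofs towards the core fact
`Literature.MathematicalPhysics.KineticTheory.gallavotti_lorentz_tendsto_dual` of `LorentzGasGallavotti`)

Three general-purpose steps of the proof of F3a (Gallavotti 1972; Golse 2012, end of the proof of
Thm. 2.1: the Markov part converges to the Duhamel series, the recollision part has vanishing
mass by conservation of mass and Fatou; Spohn 1991, proof of Thm. 8.8):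

* `Kinetic.lorentzDualTerm_const`, `Kinetic.lorentzDualSeries_const` (**mass one**): for a constant
  observable `a`, `wₙ[a](t, x, v) = a e^{-Λ} Λⁿ/n!`, `Λ = σν(v)t` — the probability of exactly `n`
  collisions of the random flight — and `(P_t a)(x, v) = ∑ₙ wₙ[a] = a`: the limiting process is
  conservative (`P_t 1 = 1`), the counterpart of Golse's conservation-of-mass argument;
* `Kinetic.tsum_lintegral_le_lintegral_tsum` (**superadditivity**): `∑ₙ ∫⁻ fₙ ≤ ∫⁻ ∑ₙ fₙ` for
  arbitrary (not necessarily measurable) `fₙ ≥ 0` — only this direction is used, so that the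
  tuple-sum functionals of the Lorentz gas need not be shown measurable;
* `Hilbert6.gallavotti_lorentz_tendsto_dual_of_lowerBound` (**reduction**): it suffices to prove,
  for nonnegative bounded continuous observables and `t ≥ 0`, the a.e. *lower bound*
  "`∀ η > 0`, eventually `(P_t φ)(z) - η ≤ 𝔼_k φ(T^c_t z)`"; the matching upper bound follows by
  applying it to `C - φ`, using linearity of `P_t` (`Kinetic.lorentzDualSeries_sub`) and `P_t 1 = 1`.

## References

* F. Golse, *Recent results on the periodic Lorentz gas*, Springer Basel (2011), §2, proof of
  Thm. 2.1 (arXiv:0906.0191).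
* H. Spohn, *Large Scale Dynamics of Interacting Particles*, Springer (1991), proof of Thm. 8.8.
-/

open MeasureTheory Metric Real Set Filter Topology
open scoped InnerProductSpace ENNReal

namespace Literature.MathematicalPhysics.KineticTheory

noncomputable section

section Kinetic

variable {d : Type*} [Fintype d]

/-- The gain operator of a function that is constant on the energy shell of `v`:
`(L⁺ g)(v) = ν(v) · K` when `g(v - 2(v·ω)ω) = K` for all `ω`. [folklore] -/
theorem lorentzGainOp_eq_of_forall_eq {E : Type*} [NormedAddCommGroup E] [InnerProductSpace ℝ E]
    [FiniteDimensional ℝ E] [MeasurableSpace E] [BorelSpace E] {g : E → ℝ} {v : E} {K : ℝ}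
    (h : ∀ ω : sphere (0 : E) 1, g (v - (2 * ⟪v, (ω : E)⟫_ℝ) • (ω : E)) = K) :
    lorentzGainOp g v = lorentzLossRate v * K := by
  rw [← lorentzGainOp_const K v]
  unfold lorentzGainOp
  exact integral_congr_ae (Eventually.of_forall fun ω => by simp only [h ω])

/-- **The backward terms of a constant observable are the Poisson probabilities**: for `t ≥ 0`,
`wₙ[a](t, x, v) = a e^{-σν(v)t} (σν(v)t)ⁿ / n!` (exactly `n` collisions of the random flight in
`[0, t]`; the loss frequency is constant along the flight). [folklore] -/
theorem lorentzDualTerm_const (σ a : ℝ) (n : ℕ) {t : ℝ} (ht : 0 ≤ t) (x v : EuclideanSpace ℝ d) :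
    lorentzDualTerm (Literature.Analysis.FluidPDE.Euclidean.geometry d) σ (fun _ _ => a) n t x v =
      a * exp (-(σ * lorentzLossRate v * t)) * (σ * lorentzLossRate v * t) ^ n / (Nat.factorial n : ℝ) := by
  induction n generalizing t x v with
  | zero => simp [lorentzDualTerm_zero, mul_comm]
  | succ n ih =>
    rw [lorentzDualTerm_succ]
    -- the gain of the (shell-constant) previous term
    have hgain : ∀ s ∈ uIcc (0 : ℝ) t, lorentzGainOp (lorentzDualTerm (Literature.Analysis.FluidPDE.Euclidean.geometry d) σ
        (fun _ _ => a) n (t - s) ((Literature.Analysis.FluidPDE.Euclidean.geometry d).translate x (s • v))) v =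
        lorentzLossRate v * (a * exp (-(σ * lorentzLossRate v * (t - s))) *
          (σ * lorentzLossRate v * (t - s)) ^ n / (Nat.factorial n : ℝ)) := by
      intro s hs
      rw [uIcc_of_le ht] at hs
      refine lorentzGainOp_eq_of_forall_eq fun ω => ?_
      rw [ih (sub_nonneg.2 hs.2), lorentzLossRate_reflect]
    rw [intervalIntegral.integral_congr fun s hs => by
      rw [hgain s hs]]
    -- compute the time integral
    have hexp : ∀ s : ℝ, exp (-(σ * lorentzLossRate v * s)) * exp (-(σ * lorentzLossRate v * (t - s))) =
        exp (-(σ * lorentzLossRate v * t)) := fun s => by rw [← exp_add]; congr 1; ring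
    have hrew : ∀ s : ℝ, exp (-(σ * lorentzLossRate v * s)) * (σ * (lorentzLossRate v *
        (a * exp (-(σ * lorentzLossRate v * (t - s))) * (σ * lorentzLossRate v * (t - s)) ^ n /
          (Nat.factorial n : ℝ)))) =
        (a * exp (-(σ * lorentzLossRate v * t)) * (σ * lorentzLossRate v) ^ (n + 1) /
          (Nat.factorial n : ℝ)) * (t - s) ^ n := fun s => by
      rw [← hexp s, mul_pow]; ring
    simp_rw [hrew]
    rw [intervalIntegral.integral_const_mul]
    have hpow : ∫ s in (0 : ℝ)..t, (t - s) ^ n = t ^ (n + 1) / (n + 1) := by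
      rw [intervalIntegral.integral_comp_sub_left (fun u => u ^ n) t, sub_self, sub_zero, integral_pow]
      simp
    rw [hpow, Nat.factorial_succ, Nat.cast_mul, Nat.cast_succ, mul_pow]
    field_simp
    ring

/-- **`P_t a = a`: the backward series of a constant observable** (`σ ≥ 0`, `t ≥ 0`): the random
flight is conservative (`∑ₙ e^{-Λ}Λⁿ/n! = 1`). This is the total-mass identity behind the
vanishing of the recollision part in Gallavotti's proof. [folklore] -/
theorem lorentzDualSeries_const {σ : ℝ} (hσ : 0 ≤ σ) (a : ℝ) {t : ℝ} (ht : 0 ≤ t)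
    (x v : EuclideanSpace ℝ d) :
    lorentzDualSeries (Literature.Analysis.FluidPDE.Euclidean.geometry d) σ (fun _ _ => a) t x v = a := by
  rw [lorentzDualSeries_apply]
  simp_rw [lorentzDualTerm_const σ a _ ht x v]
  exact (hasSum_dualBound a (σ * lorentzLossRate v * t)
    (mul_nonneg (mul_nonneg hσ (lorentzLossRate_nonneg v)) ht)).tsum_eq

/-- **Superadditivity of the lower integral over series, without measurability**:
`∑ₙ ∫⁻ fₙ ≤ ∫⁻ ∑ₙ fₙ` for every sequence of `[0, ∞]`-valued functions (finite superadditivity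
`MeasureTheory.le_lintegral_add` and monotonicity; equality would need measurability).
[folklore] -/
theorem tsum_lintegral_le_lintegral_tsum {α : Type*} [MeasurableSpace α] (μ : Measure α)
    (f : ℕ → α → ℝ≥0∞) : ∑' n, ∫⁻ a, f n a ∂μ ≤ ∫⁻ a, ∑' n, f n a ∂μ := by
  rw [ENNReal.tsum_eq_iSup_nat]
  refine iSup_le fun N => ?_
  have hfin : ∀ N : ℕ, ∑ n ∈ Finset.range N, ∫⁻ a, f n a ∂μ ≤ ∫⁻ a, ∑ n ∈ Finset.range N, f n a ∂μ := by
    intro N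
    induction N with
    | zero => simp
    | succ N ih =>
      rw [Finset.sum_range_succ]
      calc ∑ n ∈ Finset.range N, ∫⁻ a, f n a ∂μ + ∫⁻ a, f N a ∂μ
          ≤ ∫⁻ a, ∑ n ∈ Finset.range N, f n a ∂μ + ∫⁻ a, f N a ∂μ := add_le_add ih le_rfl
        _ ≤ ∫⁻ a, (∑ n ∈ Finset.range N, f n a + f N a) ∂μ := le_lintegral_add _ _
        _ = ∫⁻ a, ∑ n ∈ Finset.range (N + 1), f n a ∂μ := by simp [Finset.sum_range_succ]
  refine (hfin N).trans (lintegral_mono fun a => ?_)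
  exact ENNReal.sum_le_tsum _

end Kinetic

section Hilbert6

variable {d : Type*} [Fintype d]

/-- **Reduction of F3a to an a.e. lower bound for nonnegative observables.** Suppose that for
every `d ≥ 2`, Boltzmann–Grad Poisson data as in `gallavotti_lorentz_tendsto_dual`, every
continuous `φ` with `0 ≤ φ ≤ C` and every `t ≥ 0`, for a.e. initial state `z` the annealed
transition expectations asymptotically dominate the backward series:
`∀ η > 0, eventually (P_t φ)(z) - η ≤ 𝔼_{P k} φ(T^c_t z)`. Then F3a holds: for a bounded
continuous `φ` apply the hypothesis to `φ + C ≥ 0` and to `C - φ ≥ 0`; since expectations and the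
backward series are linear in the observable (`Kinetic.lorentzDualSeries_sub`) and `P_t C = C`
(`Kinetic.lorentzDualSeries_const`), this gives matching lower and upper bounds. (Golse 2012, end
of the proof of Thm. 2.1: Markov part + conservation of mass.) [cite: Golse2011, Thm. 2.1 (proof, last step)] -/
theorem gallavotti_lorentz_tendsto_dual_of_lowerBound
    (h : ∀ (_hd : 2 ≤ Fintype.card d) {σ : ℝ} (_hσ : 0 < σ) (ε : ℕ → ℝ) (_hε : ∀ k, 0 < ε k)
      (_hε₀ : Tendsto ε atTop (𝓝 0)) (P : ℕ → Measure (Literature.Analysis.FunctionSpaces.PointConfig (EuclideanSpace ℝ d)))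
      (_hP : ∀ k, Literature.Analysis.FunctionSpaces.IsPoissonPointProcess (ENNReal.ofReal (σ * (ε k ^ (Fintype.card d - 1))⁻¹) •
        (volume : Measure (EuclideanSpace ℝ d))) (P k))
      (Λ : ∀ k, Literature.Analysis.FunctionSpaces.LorentzFlow (ε k) (P k)) (φ : EuclideanSpace ℝ d × EuclideanSpace ℝ d → ℝ)
      (_hφ : Continuous φ) (_hφ0 : ∀ z, 0 ≤ φ z) (_hφb : ∃ C, ∀ z, φ z ≤ C) (t : ℝ) (_ht : 0 ≤ t),
      ∀ᵐ z : EuclideanSpace ℝ d × EuclideanSpace ℝ d, ∀ η > (0 : ℝ), ∀ᶠ k in atTop,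
        KineticTheory.lorentzDualSeries (Literature.Analysis.FluidPDE.Euclidean.geometry d) σ (Function.curry φ) t z.1 z.2 - η ≤
          ∫ c, φ ((Λ k).flow c t z) ∂P k) :
    gallavotti_lorentz_tendsto_dual (d := d) := by
  intro hd σ hσ ε hε hε₀ P hP Λ φ hφ hφb t ht
  obtain ⟨C, hC⟩ := hφb
  haveI : ∀ k, IsProbabilityMeasure (P k) := fun k => (hP k).isProbabilityMeasure
  have hC0 : 0 ≤ C := (abs_nonneg _).trans (hC 0)
  -- the two nonnegative observables
  set φp : EuclideanSpace ℝ d × EuclideanSpace ℝ d → ℝ := fun z => φ z + C with hφp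
  set φm : EuclideanSpace ℝ d × EuclideanSpace ℝ d → ℝ := fun z => C - φ z with hφm
  have hp := h hd hσ ε hε hε₀ P hP Λ φp (hφ.add continuous_const)
    (fun z => by rw [hφp]; linarith [neg_abs_le (φ z), hC z])
    ⟨2 * C, fun z => by rw [hφp]; dsimp only; linarith [le_abs_self (φ z), hC z]⟩ t ht
  have hm := h hd hσ ε hε hε₀ P hP Λ φm (continuous_const.sub hφ)
    (fun z => by rw [hφm]; dsimp only; linarith [le_abs_self (φ z), hC z])
    ⟨2 * C, fun z => by rw [hφm]; dsimp only; linarith [neg_abs_le (φ z), hC z]⟩ t ht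
  -- integrals of the shifted observables
  have hint : ∀ (k : ℕ) (z : EuclideanSpace ℝ d × EuclideanSpace ℝ d),
      Integrable (fun c => φ ((Λ k).flow c t z)) (P k) := fun k z => by
    refine Integrable.mono' (integrable_const C) ?_ (Eventually.of_forall fun c => ?_)
    · exact (hφ.measurable.comp ((Λ k).measurable_flow.comp (measurable_id.prodMk
        (measurable_const.prodMk measurable_const)))).aestronglyMeasurable
    · rw [Real.norm_eq_abs]; exact hC _
  have hEp : ∀ (k : ℕ) (z : EuclideanSpace ℝ d × EuclideanSpace ℝ d),
      ∫ c, φp ((Λ k).flow c t z) ∂P k = (∫ c, φ ((Λ k).flow c t z) ∂P k) + C := fun k z => by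
    rw [hφp]
    dsimp only
    rw [integral_add (hint k z) (integrable_const C), integral_const, probReal_univ,
      one_smul]
  have hEm : ∀ (k : ℕ) (z : EuclideanSpace ℝ d × EuclideanSpace ℝ d),
      ∫ c, φm ((Λ k).flow c t z) ∂P k = C - ∫ c, φ ((Λ k).flow c t z) ∂P k := fun k z => by
    rw [hφm]
    dsimp only
    rw [integral_sub (integrable_const C) (hint k z), integral_const, probReal_univ,
      one_smul]
  -- the backward series of the shifted observables
  have hCabs : ∀ z : EuclideanSpace ℝ d × EuclideanSpace ℝ d, |φ z| ≤ C := hC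
  have hDp : ∀ z : EuclideanSpace ℝ d × EuclideanSpace ℝ d,
      KineticTheory.lorentzDualSeries (Literature.Analysis.FluidPDE.Euclidean.geometry d) σ (Function.curry φp) t z.1 z.2 =
        KineticTheory.lorentzDualSeries (Literature.Analysis.FluidPDE.Euclidean.geometry d) σ (Function.curry φ) t z.1 z.2 + C := by
    intro z
    have hsub := KineticTheory.lorentzDualSeries_sub hσ.le (ψ₁ := Function.curry φp) (ψ₂ := fun _ _ => C)
      ((hφ.add continuous_const).comp (continuous_fst.prodMk continuous_snd)) continuous_const
      (C₁ := 2 * C) (C₂ := C) (fun x v => by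
        rw [Function.curry_apply, hφp]; dsimp only
        rw [abs_le]; constructor <;> linarith [neg_abs_le (φ (x, v)), le_abs_self (φ (x, v)), hC (x, v)])
      (fun _ _ => by rw [abs_of_nonneg hC0]) ht z.1 z.2
    have hcurry : (fun y w => Function.curry φp y w - C) = Function.curry φ := by
      funext y w; simp [hφp, Function.curry]
    rw [hcurry, KineticTheory.lorentzDualSeries_const hσ.le C ht] at hsub
    linarith
  have hDm : ∀ z : EuclideanSpace ℝ d × EuclideanSpace ℝ d,
      KineticTheory.lorentzDualSeries (Literature.Analysis.FluidPDE.Euclidean.geometry d) σ (Function.curry φm) t z.1 z.2 =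
        C - KineticTheory.lorentzDualSeries (Literature.Analysis.FluidPDE.Euclidean.geometry d) σ (Function.curry φ) t z.1 z.2 := by
    intro z
    have hsub := KineticTheory.lorentzDualSeries_sub hσ.le (ψ₁ := fun _ _ => C) (ψ₂ := Function.curry φ)
      continuous_const (hφ.comp (continuous_fst.prodMk continuous_snd))
      (C₁ := C) (C₂ := C) (fun _ _ => by rw [abs_of_nonneg hC0]) (fun x v => hC (x, v)) ht z.1 z.2
    have hcurry : (fun y w => C - Function.curry φ y w) = Function.curry φm := by
      funext y w; simp [hφm, Function.curry]
    rw [← hcurry, hsub, KineticTheory.lorentzDualSeries_const hσ.le C ht]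
  -- conclude: two-sided eventual bounds
  filter_upwards [hp, hm] with z hzp hzm
  rw [tendsto_order]
  constructor
  · intro a ha
    obtain ⟨η, hη, haη⟩ : ∃ η > 0, a + η ≤
        KineticTheory.lorentzDualSeries (Literature.Analysis.FluidPDE.Euclidean.geometry d) σ (Function.curry φ) t z.1 z.2 :=
      ⟨(KineticTheory.lorentzDualSeries (Literature.Analysis.FluidPDE.Euclidean.geometry d) σ (Function.curry φ) t z.1 z.2 - a) / 2,
        by linarith, by linarith⟩
    filter_upwards [hzp (η / 2) (by linarith)] with k hk
    rw [hDp, hEp] at hk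
    linarith
  · intro b hb
    obtain ⟨η, hη, hbη⟩ : ∃ η > 0,
        KineticTheory.lorentzDualSeries (Literature.Analysis.FluidPDE.Euclidean.geometry d) σ (Function.curry φ) t z.1 z.2 + η ≤ b :=
      ⟨(b - KineticTheory.lorentzDualSeries (Literature.Analysis.FluidPDE.Euclidean.geometry d) σ (Function.curry φ) t z.1 z.2) / 2,
        by linarith, by linarith⟩
    filter_upwards [hzm (η / 2) (by linarith)] with k hk
    rw [hDm, hEm] at hk
    linarith

end Hilbert6

end

end Literature.MathematicalPhysics.KineticTheory
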